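import Mathlib

/-!
# Route BarrierLever — item `PartitionMinorsHitByVP` (stmt-ValiantsHypothesis-19717), line `hidden-states`:
# BALL-DIAGONAL VI — the structure of a down-set of co-size `h + 1` (PROOF-balldiagonal §0)

Helper file (`--supports stmt-ValiantsHypothesis-19717`; cell valiant-natproofs, rung V4, 𝒟-side door (c), registered line
`Cruxes/PartitionMinorsHitByVP/Lines/hidden_states.lean` v8; prover seat val-np-p6 gen 13). Definition-free; closes NO item.

THE FACT (HOME/val-np-p6/g12/PROOF-balldiagonal-p6g12.md §0). Let `U ⊆ 2^{[h]}` be a down-set with `|U| = 2^h − h − 1`, given as an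
injective row family `u`, and let `𝒜 = 2^{[h]} ∖ U` (an up-set of `h + 1` sets) with CORE `C = ∩𝒜` and non-core block `N = [h] ∖ C`.
Then `𝒜 = {[h]} ∪ {[h] ∖ y : y ∈ N} ∪ {[h] ∖ E : E ∈ 𝔈}` where the MISSING COMPLEX `𝔈` is a family of exactly `|C|` subsets of `N`,
each of size `≥ 2`, closed under sub-faces of size `≥ 2`; in particular there is a bijection `F : C → 𝔈` (any one; the σ of the
σ-table). `coSize_structure` packages exactly the data consumed by the row-kernel theorem (`…BallTop.rowKernel_zero`) and by the
σ-table (`Tilt.exists_sigmaTable`, p630805): `C`, `N = univ ∖ C`, `𝔈`, `F` (extended by `∅` off `C`), and the classification of the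
non-rows.

WHAT THIS IS NOT: combinatorial bookkeeping; nothing on crux 14610 or VP ≠ VNP.
-/

set_option linter.dupNamespace false

namespace Summit.ValiantsHypothesis.ValiantsHypothesis.Theorems.BarrierLever.HiddenStates

open Finset

noncomputable section

namespace BallDiag

/-- **THE STRUCTURE OF A DOWN-SET OF CO-SIZE `h + 1`.** See the module docstring. -/
theorem coSize_structure (h r : ℕ) (u : Fin r → Finset (Fin h)) (hu : Function.Injective u)
    (hlow : IsLowerSet (Set.range u)) (hr : r + (h + 1) = 2 ^ h) :
    ∃ (C N : Finset (Fin h)) (𝔈 : Finset (Finset (Fin h))) (F : Fin h → Finset (Fin h)),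
      N = Finset.univ \ C ∧ (∀ E ∈ 𝔈, E ⊆ N) ∧ (∀ E ∈ 𝔈, 2 ≤ E.card) ∧
      (∀ E ∈ 𝔈, ∀ G, G ⊆ E → 2 ≤ G.card → G ∈ 𝔈) ∧
      (∀ c ∈ C, F c ∈ 𝔈) ∧ (∀ c ∈ C, ∀ c' ∈ C, F c = F c' → c = c') ∧ (∀ c, c ∉ C → F c = ∅) ∧
      (∀ S : Finset (Fin h), S ∉ Set.range u →
        S = Finset.univ ∨ (∃ y ∈ N, S = Finset.univ.erase y) ∨ (∃ E ∈ 𝔈, S = Finset.univ \ E)) := by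
  classical
  -- the missing up-set
  set 𝒜 : Finset (Finset (Fin h)) := Finset.univ \ Finset.univ.image u with h𝒜
  have h𝒜c : 𝒜.card = h + 1 := by
    rw [h𝒜, Finset.card_sdiff_of_subset (Finset.subset_univ _), Finset.card_univ, Fintype.card_finset, Fintype.card_fin,
      Finset.card_image_of_injective _ hu, Finset.card_univ, Fintype.card_fin]
    omega
  have hrowiff : ∀ S, S ∈ Set.range u ↔ S ∉ 𝒜 := by
    intro S
    rw [h𝒜, Finset.mem_sdiff, not_and, not_not, Finset.mem_image]
    constructor
    · rintro ⟨i, rfl⟩ _; exact ⟨i, Finset.mem_univ _, rfl⟩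
    · intro hS; obtain ⟨i, -, hi⟩ := hS (Finset.mem_univ _); exact ⟨i, hi⟩
  have hup : ∀ A ∈ 𝒜, ∀ A', A ⊆ A' → A' ∈ 𝒜 := by
    intro A hA A' hAA'
    rw [h𝒜, Finset.mem_sdiff] at hA ⊢
    refine ⟨Finset.mem_univ _, fun hA' => hA.2 ?_⟩
    obtain ⟨i, -, rfl⟩ := Finset.mem_image.mp hA'
    obtain ⟨j, hj⟩ := hlow hAA' ⟨i, rfl⟩
    exact Finset.mem_image.mpr ⟨j, Finset.mem_univ _, hj⟩
  have hne : 𝒜.Nonempty := by rw [← Finset.card_pos, h𝒜c]; omega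
  have huniv : (Finset.univ : Finset (Fin h)) ∈ 𝒜 := by
    obtain ⟨A, hA⟩ := hne; exact hup A hA _ (Finset.subset_univ A)
  -- core and non-core block
  set C : Finset (Fin h) := Finset.univ.filter fun x => ∀ A ∈ 𝒜, x ∈ A with hC
  set N : Finset (Fin h) := Finset.univ \ C with hN
  have hmemN : ∀ y, y ∈ N ↔ ∃ A ∈ 𝒜, y ∉ A := by
    intro y
    simp only [hN, hC, Finset.mem_sdiff, Finset.mem_univ, Finset.mem_filter, true_and, not_forall]
    constructor
    · rintro ⟨A, hA, hyA⟩; exact ⟨A, hA, hyA⟩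
    · rintro ⟨A, hA, hyA⟩; exact ⟨A, hA, hyA⟩
  have hCA : ∀ A ∈ 𝒜, C ⊆ A := fun A hA x hx => (Finset.mem_filter.mp hx).2 A hA
  have herase : ∀ y ∈ N, Finset.univ.erase y ∈ 𝒜 := by
    intro y hy
    obtain ⟨A, hA, hyA⟩ := (hmemN y).mp hy
    exact hup A hA _ fun z hz => Finset.mem_erase.mpr ⟨fun hzy => hyA (hzy ▸ hz), Finset.mem_univ z⟩
  have hsn : C.card + N.card = h := by
    rw [hN, Finset.card_sdiff_of_subset (Finset.subset_univ C), Finset.card_univ, Fintype.card_fin]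
    have : C.card ≤ h := by simpa using Finset.card_le_univ C
    omega
  -- the missing complex
  set 𝔈 : Finset (Finset (Fin h)) := N.powerset.filter fun E => 2 ≤ E.card ∧ Finset.univ \ E ∈ 𝒜 with h𝔈
  have hclass : ∀ A ∈ 𝒜, A = Finset.univ ∨ (∃ y ∈ N, A = Finset.univ.erase y) ∨ (∃ E ∈ 𝔈, A = Finset.univ \ E) := by
    intro A hA
    have hEN : Finset.univ \ A ⊆ N := by
      intro x hx
      rw [Finset.mem_sdiff] at hx
      exact (hmemN x).mpr ⟨A, hA, hx.2⟩
    have hAE : A = Finset.univ \ (Finset.univ \ A) := (Finset.sdiff_sdiff_eq_self (Finset.subset_univ A)).symm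
    by_cases h0 : (Finset.univ \ A).card = 0
    · left
      rw [hAE, Finset.card_eq_zero.mp h0, Finset.sdiff_empty]
    by_cases h1 : (Finset.univ \ A).card = 1
    · right; left
      obtain ⟨y, hy⟩ := Finset.card_eq_one.mp h1
      refine ⟨y, hEN (by rw [hy]; exact Finset.mem_singleton_self y), ?_⟩
      rw [hAE, hy, Finset.sdiff_singleton_eq_erase]
    · right; right
      refine ⟨Finset.univ \ A, Finset.mem_filter.mpr ⟨Finset.mem_powerset.mpr hEN, by omega, ?_⟩, hAE⟩
      rw [← hAE]; exact hA
  -- counting: |𝔈| = |C|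
  have hcount : 𝔈.card = C.card := by
    have hXuniv : Finset.univ ∉ N.image (fun y => Finset.univ.erase y) := by
      intro h'
      obtain ⟨y, -, hy⟩ := Finset.mem_image.mp h'
      have : y ∉ Finset.univ.erase y := Finset.notMem_erase y _
      rw [hy] at this
      exact this (Finset.mem_univ y)
    have hYuniv : Finset.univ ∉ 𝔈.image (fun E => Finset.univ \ E) := by
      intro h'
      obtain ⟨E, hE, hE'⟩ := Finset.mem_image.mp h'
      have h2 := (Finset.mem_filter.mp hE).2.1
      have : E = ∅ := by
        have := Finset.sdiff_sdiff_eq_self (Finset.subset_univ E)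
        rw [hE', Finset.sdiff_self] at this
        exact this.symm
      rw [this, Finset.card_empty] at h2
      omega
    have hXY : Disjoint (N.image fun y => Finset.univ.erase y) (𝔈.image fun E => Finset.univ \ E) := by
      rw [Finset.disjoint_left]
      intro A hAX hAY
      obtain ⟨y, -, rfl⟩ := Finset.mem_image.mp hAX
      obtain ⟨E, hE, hE'⟩ := Finset.mem_image.mp hAY
      have h2 := (Finset.mem_filter.mp hE).2.1
      have : E = {y} := by
        have := Finset.sdiff_sdiff_eq_self (Finset.subset_univ E)
        rw [hE', ← Finset.sdiff_singleton_eq_erase, Finset.sdiff_sdiff_eq_self (Finset.subset_univ _)] at this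
        exact this.symm
      rw [this, Finset.card_singleton] at h2
      omega
    have hXc : (N.image fun y => Finset.univ.erase y).card = N.card :=
      Finset.card_image_of_injOn fun y _ y' _ hyy => Finset.erase_injOn _ (Finset.mem_univ y) (Finset.mem_univ y') hyy
    have hYc : (𝔈.image fun E => Finset.univ \ E).card = 𝔈.card := by
      refine Finset.card_image_of_injOn fun E _ E' _ hEE => ?_
      have h1 := Finset.sdiff_sdiff_eq_self (Finset.subset_univ E)
      have h2 := Finset.sdiff_sdiff_eq_self (Finset.subset_univ E')
      rw [← h1, ← h2, hEE]
    have h𝒜eq : 𝒜 = insert Finset.univ ((N.image fun y => Finset.univ.erase y) ∪ 𝔈.image fun E => Finset.univ \ E) := by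
      ext A
      simp only [Finset.mem_insert, Finset.mem_union, Finset.mem_image]
      constructor
      · intro hA
        rcases hclass A hA with h' | ⟨y, hy, h'⟩ | ⟨E, hE, h'⟩
        · exact Or.inl h'
        · exact Or.inr (Or.inl ⟨y, hy, h'.symm⟩)
        · exact Or.inr (Or.inr ⟨E, hE, h'.symm⟩)
      · rintro (rfl | ⟨y, hy, rfl⟩ | ⟨E, hE, rfl⟩)
        · exact huniv
        · exact herase y hy
        · exact (Finset.mem_filter.mp hE).2.2
    have hcard := h𝒜c
    rw [h𝒜eq, Finset.card_insert_of_notMem (by rw [Finset.mem_union, not_or]; exact ⟨hXuniv, hYuniv⟩),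
      Finset.card_union_of_disjoint hXY, hXc, hYc] at hcard
    omega
  -- a bijection `C → 𝔈`, extended by `∅`
  have hcardeq : Fintype.card ↥C = Fintype.card ↥𝔈 := by
    rw [Fintype.card_coe, Fintype.card_coe, hcount]
  let σ : ↥C ≃ ↥𝔈 := Fintype.equivOfCardEq hcardeq
  let F : Fin h → Finset (Fin h) := fun c => if hc : c ∈ C then (σ ⟨c, hc⟩).1 else ∅
  have hFC : ∀ c (hc : c ∈ C), F c = (σ ⟨c, hc⟩).1 := fun c hc => by simp only [F, dif_pos hc]
  refine ⟨C, N, 𝔈, F, rfl, ?_, ?_, ?_, ?_, ?_, ?_, ?_⟩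
  · intro E hE; exact Finset.mem_powerset.mp (Finset.mem_filter.mp hE).1
  · intro E hE; exact (Finset.mem_filter.mp hE).2.1
  · intro E hE G hGE hG
    obtain ⟨hEN, -, hEA⟩ := Finset.mem_filter.mp hE
    refine Finset.mem_filter.mpr ⟨Finset.mem_powerset.mpr (hGE.trans (Finset.mem_powerset.mp hEN)), hG, ?_⟩
    exact hup _ hEA _ (Finset.sdiff_subset_sdiff (subset_refl _) hGE)
  · intro c hc; rw [hFC c hc]; exact (σ ⟨c, hc⟩).2
  · intro c hc c' hc' hcc
    rw [hFC c hc, hFC c' hc'] at hcc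
    have := σ.injective (Subtype.ext hcc)
    exact congrArg Subtype.val this
  · intro c hc; simp only [F, dif_neg hc]
  · intro S hS
    exact hclass S (by rwa [hrowiff, not_not] at hS)

/-- **THE STRUCTURE OF A DOWN-SET OF CO-SIZE `h + 1`, with the EXACT classification of the non-rows** (the last clause is an
`↔`: the sets `univ`, `univ ∖ y` (`y ∈ N`) and `univ ∖ E` (`E ∈ 𝔈`) are exactly the non-rows). Supersedes `coSize_structure`
(same construction; needed by the row-kernel theorem, whose vanishing hypotheses live on these sets). -/
theorem coSize_structure_iff (h r : ℕ) (u : Fin r → Finset (Fin h)) (hu : Function.Injective u)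
    (hlow : IsLowerSet (Set.range u)) (hr : r + (h + 1) = 2 ^ h) :
    ∃ (C N : Finset (Fin h)) (𝔈 : Finset (Finset (Fin h))) (F : Fin h → Finset (Fin h)),
      N = Finset.univ \ C ∧ (∀ E ∈ 𝔈, E ⊆ N) ∧ (∀ E ∈ 𝔈, 2 ≤ E.card) ∧
      (∀ E ∈ 𝔈, ∀ G, G ⊆ E → 2 ≤ G.card → G ∈ 𝔈) ∧
      (∀ c ∈ C, F c ∈ 𝔈) ∧ (∀ c ∈ C, ∀ c' ∈ C, F c = F c' → c = c') ∧ (∀ c, c ∉ C → F c = ∅) ∧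
      (∀ S : Finset (Fin h), S ∉ Set.range u ↔
        (S = Finset.univ ∨ (∃ y ∈ N, S = Finset.univ.erase y) ∨ (∃ E ∈ 𝔈, S = Finset.univ \ E))) := by
  classical
  -- the missing up-set
  set 𝒜 : Finset (Finset (Fin h)) := Finset.univ \ Finset.univ.image u with h𝒜
  have h𝒜c : 𝒜.card = h + 1 := by
    rw [h𝒜, Finset.card_sdiff_of_subset (Finset.subset_univ _), Finset.card_univ, Fintype.card_finset, Fintype.card_fin,
      Finset.card_image_of_injective _ hu, Finset.card_univ, Fintype.card_fin]
    omega
  have hrowiff : ∀ S, S ∈ Set.range u ↔ S ∉ 𝒜 := by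
    intro S
    rw [h𝒜, Finset.mem_sdiff, not_and, not_not, Finset.mem_image]
    constructor
    · rintro ⟨i, rfl⟩ _; exact ⟨i, Finset.mem_univ _, rfl⟩
    · intro hS; obtain ⟨i, -, hi⟩ := hS (Finset.mem_univ _); exact ⟨i, hi⟩
  have hup : ∀ A ∈ 𝒜, ∀ A', A ⊆ A' → A' ∈ 𝒜 := by
    intro A hA A' hAA'
    rw [h𝒜, Finset.mem_sdiff] at hA ⊢
    refine ⟨Finset.mem_univ _, fun hA' => hA.2 ?_⟩
    obtain ⟨i, -, rfl⟩ := Finset.mem_image.mp hA'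
    obtain ⟨j, hj⟩ := hlow hAA' ⟨i, rfl⟩
    exact Finset.mem_image.mpr ⟨j, Finset.mem_univ _, hj⟩
  have hne : 𝒜.Nonempty := by rw [← Finset.card_pos, h𝒜c]; omega
  have huniv : (Finset.univ : Finset (Fin h)) ∈ 𝒜 := by
    obtain ⟨A, hA⟩ := hne; exact hup A hA _ (Finset.subset_univ A)
  -- core and non-core block
  set C : Finset (Fin h) := Finset.univ.filter fun x => ∀ A ∈ 𝒜, x ∈ A with hC
  set N : Finset (Fin h) := Finset.univ \ C with hN
  have hmemN : ∀ y, y ∈ N ↔ ∃ A ∈ 𝒜, y ∉ A := by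
    intro y
    simp only [hN, hC, Finset.mem_sdiff, Finset.mem_univ, Finset.mem_filter, true_and, not_forall]
    constructor
    · rintro ⟨A, hA, hyA⟩; exact ⟨A, hA, hyA⟩
    · rintro ⟨A, hA, hyA⟩; exact ⟨A, hA, hyA⟩
  have hCA : ∀ A ∈ 𝒜, C ⊆ A := fun A hA x hx => (Finset.mem_filter.mp hx).2 A hA
  have herase : ∀ y ∈ N, Finset.univ.erase y ∈ 𝒜 := by
    intro y hy
    obtain ⟨A, hA, hyA⟩ := (hmemN y).mp hy
    exact hup A hA _ fun z hz => Finset.mem_erase.mpr ⟨fun hzy => hyA (hzy ▸ hz), Finset.mem_univ z⟩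
  have hsn : C.card + N.card = h := by
    rw [hN, Finset.card_sdiff_of_subset (Finset.subset_univ C), Finset.card_univ, Fintype.card_fin]
    have : C.card ≤ h := by simpa using Finset.card_le_univ C
    omega
  -- the missing complex
  set 𝔈 : Finset (Finset (Fin h)) := N.powerset.filter fun E => 2 ≤ E.card ∧ Finset.univ \ E ∈ 𝒜 with h𝔈
  have hclass : ∀ A ∈ 𝒜, A = Finset.univ ∨ (∃ y ∈ N, A = Finset.univ.erase y) ∨ (∃ E ∈ 𝔈, A = Finset.univ \ E) := by
    intro A hA
    have hEN : Finset.univ \ A ⊆ N := by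
      intro x hx
      rw [Finset.mem_sdiff] at hx
      exact (hmemN x).mpr ⟨A, hA, hx.2⟩
    have hAE : A = Finset.univ \ (Finset.univ \ A) := (Finset.sdiff_sdiff_eq_self (Finset.subset_univ A)).symm
    by_cases h0 : (Finset.univ \ A).card = 0
    · left
      rw [hAE, Finset.card_eq_zero.mp h0, Finset.sdiff_empty]
    by_cases h1 : (Finset.univ \ A).card = 1
    · right; left
      obtain ⟨y, hy⟩ := Finset.card_eq_one.mp h1
      refine ⟨y, hEN (by rw [hy]; exact Finset.mem_singleton_self y), ?_⟩
      rw [hAE, hy, Finset.sdiff_singleton_eq_erase]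
    · right; right
      refine ⟨Finset.univ \ A, Finset.mem_filter.mpr ⟨Finset.mem_powerset.mpr hEN, by omega, ?_⟩, hAE⟩
      rw [← hAE]; exact hA
  -- counting: |𝔈| = |C|
  have hcount : 𝔈.card = C.card := by
    have hXuniv : Finset.univ ∉ N.image (fun y => Finset.univ.erase y) := by
      intro h'
      obtain ⟨y, -, hy⟩ := Finset.mem_image.mp h'
      have : y ∉ Finset.univ.erase y := Finset.notMem_erase y _
      rw [hy] at this
      exact this (Finset.mem_univ y)
    have hYuniv : Finset.univ ∉ 𝔈.image (fun E => Finset.univ \ E) := by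
      intro h'
      obtain ⟨E, hE, hE'⟩ := Finset.mem_image.mp h'
      have h2 := (Finset.mem_filter.mp hE).2.1
      have : E = ∅ := by
        have := Finset.sdiff_sdiff_eq_self (Finset.subset_univ E)
        rw [hE', Finset.sdiff_self] at this
        exact this.symm
      rw [this, Finset.card_empty] at h2
      omega
    have hXY : Disjoint (N.image fun y => Finset.univ.erase y) (𝔈.image fun E => Finset.univ \ E) := by
      rw [Finset.disjoint_left]
      intro A hAX hAY
      obtain ⟨y, -, rfl⟩ := Finset.mem_image.mp hAX
      obtain ⟨E, hE, hE'⟩ := Finset.mem_image.mp hAY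
      have h2 := (Finset.mem_filter.mp hE).2.1
      have : E = {y} := by
        have := Finset.sdiff_sdiff_eq_self (Finset.subset_univ E)
        rw [hE', ← Finset.sdiff_singleton_eq_erase, Finset.sdiff_sdiff_eq_self (Finset.subset_univ _)] at this
        exact this.symm
      rw [this, Finset.card_singleton] at h2
      omega
    have hXc : (N.image fun y => Finset.univ.erase y).card = N.card :=
      Finset.card_image_of_injOn fun y _ y' _ hyy => Finset.erase_injOn _ (Finset.mem_univ y) (Finset.mem_univ y') hyy
    have hYc : (𝔈.image fun E => Finset.univ \ E).card = 𝔈.card := by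
      refine Finset.card_image_of_injOn fun E _ E' _ hEE => ?_
      have h1 := Finset.sdiff_sdiff_eq_self (Finset.subset_univ E)
      have h2 := Finset.sdiff_sdiff_eq_self (Finset.subset_univ E')
      rw [← h1, ← h2, hEE]
    have h𝒜eq : 𝒜 = insert Finset.univ ((N.image fun y => Finset.univ.erase y) ∪ 𝔈.image fun E => Finset.univ \ E) := by
      ext A
      simp only [Finset.mem_insert, Finset.mem_union, Finset.mem_image]
      constructor
      · intro hA
        rcases hclass A hA with h' | ⟨y, hy, h'⟩ | ⟨E, hE, h'⟩
        · exact Or.inl h'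
        · exact Or.inr (Or.inl ⟨y, hy, h'.symm⟩)
        · exact Or.inr (Or.inr ⟨E, hE, h'.symm⟩)
      · rintro (rfl | ⟨y, hy, rfl⟩ | ⟨E, hE, rfl⟩)
        · exact huniv
        · exact herase y hy
        · exact (Finset.mem_filter.mp hE).2.2
    have hcard := h𝒜c
    rw [h𝒜eq, Finset.card_insert_of_notMem (by rw [Finset.mem_union, not_or]; exact ⟨hXuniv, hYuniv⟩),
      Finset.card_union_of_disjoint hXY, hXc, hYc] at hcard
    omega
  -- a bijection `C → 𝔈`, extended by `∅`
  have hcardeq : Fintype.card ↥C = Fintype.card ↥𝔈 := by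
    rw [Fintype.card_coe, Fintype.card_coe, hcount]
  let σ : ↥C ≃ ↥𝔈 := Fintype.equivOfCardEq hcardeq
  let F : Fin h → Finset (Fin h) := fun c => if hc : c ∈ C then (σ ⟨c, hc⟩).1 else ∅
  have hFC : ∀ c (hc : c ∈ C), F c = (σ ⟨c, hc⟩).1 := fun c hc => by simp only [F, dif_pos hc]
  refine ⟨C, N, 𝔈, F, rfl, ?_, ?_, ?_, ?_, ?_, ?_, ?_⟩
  · intro E hE; exact Finset.mem_powerset.mp (Finset.mem_filter.mp hE).1
  · intro E hE; exact (Finset.mem_filter.mp hE).2.1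
  · intro E hE G hGE hG
    obtain ⟨hEN, -, hEA⟩ := Finset.mem_filter.mp hE
    refine Finset.mem_filter.mpr ⟨Finset.mem_powerset.mpr (hGE.trans (Finset.mem_powerset.mp hEN)), hG, ?_⟩
    exact hup _ hEA _ (Finset.sdiff_subset_sdiff (subset_refl _) hGE)
  · intro c hc; rw [hFC c hc]; exact (σ ⟨c, hc⟩).2
  · intro c hc c' hc' hcc
    rw [hFC c hc, hFC c' hc'] at hcc
    have := σ.injective (Subtype.ext hcc)
    exact congrArg Subtype.val this
  · intro c hc; simp only [F, dif_neg hc]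
  · intro S
    constructor
    · intro hS
      exact hclass S (by rwa [hrowiff, not_not] at hS)
    · intro hS
      rw [hrowiff, not_not]
      rcases hS with rfl | ⟨y, hy, rfl⟩ | ⟨E, hE, rfl⟩
      · exact huniv
      · exact herase y hy
      · exact (Finset.mem_filter.mp hE).2.2

end BallDiag

end

end Summit.ValiantsHypothesis.ValiantsHypothesis.Theorems.BarrierLever.HiddenStates
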